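import Summits.RiemannHypothesis.RiemannHypothesis.Theorems.TiltedLandingLaw421R3SinkThin
import Summits.RiemannHypothesis.RiemannHypothesis.Theorems.TiltedLandingLaw421R3SinkLemmaH

/-!
# W-08 law421 line — regime 3′ SINK: LEMMA H ON THE THIN STRIP PROVED («SinkLemmaHThin», C1 rh-idea-5 g41; support, K-image — namespace `RhW08.SinkThin` continued, so every name keeps its sketch-of-record spelling

`lemmaHThin : RhW08.SinkThin.LemmaHThinSig` — kernel domination on the THIN BOUNDARY (`KernelDomThinBdry`) implies kernel domination on the whole thin
strip (`KernelDomThin`), for every real `σ`, all real weights and directions, every finite cut family whose points lie strictly inside the near window,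
every lid height `Hs`.  #1257 «SinkLemmaH»'s generator is CITED, not re-proved: `u ↦ N(u) − σ·c(u) = Re (sinkGen cs w σ u)` (`cutNumer_sub_eq`) is
harmonic at every far point (`sinkGen_analyticAt`) and `→ 0` along `cocompact ℂ` (`sinkGen_tendsto`).  What is new is only the REGION: the thin strip
minus its boundary is the union of the two open convex thin half-strips `thinHalfStrip xv R Hs (±1)` (`R/2 < ±(Re u − xv)`, `|Im u| < Hs`), whose
frontier lies in `ThinStripBdry` (inner column segment or a lid ray at height `±Hs`); on each, `Literature.Analysis.Complex.harmonic_le_of_frontier_of_cocompact`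
with `M = 0`.  Corollary `kernelDomThin_iff_bdry` ((K∂-thin) ⇔ (K-thin)).  Harmonic bookkeeping, not a law; all (K), sorry-free; RH is not proved here or
anywhere in this line; ⟨33346⟩/⟨33347⟩ OPEN.
-/

namespace RhW08.SinkThin

open Complex
open scoped ComplexConjugate
open RhW08.SinkTemplate RhW08.SinkBdry RhW08.SinkConePos

section LemmaHThin

open Filter Set Topology InnerProductSpace
open RhW08.SinkLemmaH (sinkGen cutNumer_sub_eq sinkGen_analyticAt sinkGen_tendsto abs_side_mul)

/-- the OPEN thin half-strip on side `sd` (`sd = 1`: `Re u > xv + R/2`; `sd = −1`: `Re u < xv − R/2`), `|Im u| < Hs`. -/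
def thinHalfStrip (xv R Hs sd : ℝ) : Set ℂ :=
  {v : ℂ | R / 2 < sd * (v.re - xv)} ∩ ({v : ℂ | v.im < Hs} ∩ {v : ℂ | -Hs < v.im})

/-- each open thin half-strip is open. -/
theorem isOpen_thinHalfStrip {xv R Hs sd : ℝ} : IsOpen (thinHalfStrip xv R Hs sd) :=
  (isOpen_lt continuous_const (continuous_const.mul (Complex.continuous_re.sub continuous_const))).inter
    ((isOpen_lt Complex.continuous_im continuous_const).inter
      (isOpen_lt continuous_const Complex.continuous_im))

/-- each open thin half-strip (`sd = ±1`) is convex: an intersection of three open half-planes. -/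
theorem convex_thinHalfStrip {xv R Hs sd : ℝ} (hs : sd = 1 ∨ sd = -1) : Convex ℝ (thinHalfStrip xv R Hs sd) := by
  have h1 : Convex ℝ {v : ℂ | R / 2 < sd * (v.re - xv)} := by
    rcases hs with rfl | rfl
    · have : {v : ℂ | R / 2 < (1 : ℝ) * (v.re - xv)} = {v : ℂ | xv + R / 2 < v.re} := by
        ext v; simp only [Set.mem_setOf_eq]; constructor <;> intro h <;> linarith
      rw [this]; exact convex_halfSpace_re_gt _
    · have : {v : ℂ | R / 2 < (-1 : ℝ) * (v.re - xv)} = {v : ℂ | v.re < xv - R / 2} := by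
        ext v; simp only [Set.mem_setOf_eq]; constructor <;> intro h <;> linarith
      rw [this]; exact convex_halfSpace_re_lt _
  exact h1.inter ((convex_halfSpace_im_lt _).inter (convex_halfSpace_im_gt _))

/-- the closure of a thin half-strip satisfies the three NON-strict inequalities. -/
theorem closure_thinHalfStrip_subset {xv R Hs sd : ℝ} :
    closure (thinHalfStrip xv R Hs sd) ⊆
      {v : ℂ | R / 2 ≤ sd * (v.re - xv)} ∩ ({v : ℂ | v.im ≤ Hs} ∩ {v : ℂ | -Hs ≤ v.im}) :=
  closure_minimal
    (fun v hv =>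
      have h1 : R / 2 < sd * (v.re - xv) := hv.1
      have h2 : v.im < Hs := hv.2.1
      have h3 : -Hs < v.im := hv.2.2
      ⟨h1.le, h2.le, h3.le⟩)
    ((isClosed_le continuous_const (continuous_const.mul (Complex.continuous_re.sub continuous_const))).inter
      ((isClosed_le Complex.continuous_im continuous_const).inter
        (isClosed_le continuous_const Complex.continuous_im)))

/-- every point of the closed thin half-strip is FAR: `R/2 ≤ |Re v − xv|`. -/
theorem far_of_mem_closure_thinHalfStrip {xv R Hs sd : ℝ} (hs : sd = 1 ∨ sd = -1) {v : ℂ}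
    (hv : v ∈ closure (thinHalfStrip xv R Hs sd)) : R / 2 ≤ |v.re - xv| := by
  have h : R / 2 ≤ sd * (v.re - xv) := (closure_thinHalfStrip_subset hv).1
  rw [← abs_side_mul hs (v.re - xv)]
  exact h.trans (le_abs_self _)

/-- the frontier of an open thin half-strip lies in `ThinStripBdry` (inner column segment or a lid ray). -/
theorem frontier_thinHalfStrip_subset_bdry {xv R Hs sd : ℝ} (hR : 0 ≤ R) (hs : sd = 1 ∨ sd = -1) {ζ : ℂ}
    (hζ : ζ ∈ frontier (thinHalfStrip xv R Hs sd)) : ThinStripBdry xv R Hs ζ := by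
  have hF := closure_thinHalfStrip_subset (frontier_subset_closure hζ)
  have hζ' : ζ ∈ closure (thinHalfStrip xv R Hs sd) \ thinHalfStrip xv R Hs sd := isOpen_thinHalfStrip.frontier_eq ▸ hζ
  have hnot : ¬ (R / 2 < sd * (ζ.re - xv) ∧ (ζ.im < Hs ∧ -Hs < ζ.im)) := fun h => hζ'.2 h
  have h1 : R / 2 ≤ sd * (ζ.re - xv) := hF.1
  have h2 : ζ.im ≤ Hs := hF.2.1
  have h3 : -Hs ≤ ζ.im := hF.2.2
  have habs : |ζ.re - xv| = |sd * (ζ.re - xv)| := (abs_side_mul hs _).symm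
  have hfar : R / 2 ≤ |ζ.re - xv| := by rw [habs]; exact h1.trans (le_abs_self _)
  have him : |ζ.im| ≤ Hs := abs_le.2 ⟨h3, h2⟩
  by_cases hc : R / 2 < sd * (ζ.re - xv)
  · -- a lid point
    have hlid : ¬ (ζ.im < Hs ∧ -Hs < ζ.im) := fun h => hnot ⟨hc, h⟩
    right
    refine ⟨hfar, ?_⟩
    rcases not_and_or.1 hlid with h | h
    · have : ζ.im = Hs := le_antisymm h2 (not_lt.1 h)
      rw [this, abs_of_nonneg (by linarith)]
    · have : ζ.im = -Hs := le_antisymm (not_lt.1 h) h3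
      rw [this, abs_neg, abs_of_nonneg (by linarith)]
  · -- an inner-column point
    left
    refine ⟨?_, him⟩
    have heq : sd * (ζ.re - xv) = R / 2 := le_antisymm (not_lt.1 hc) h1
    rw [habs, heq, abs_of_nonneg (by linarith)]

/-- maximum principle on ONE open thin half-strip. -/
theorem nonpos_on_thinHalfStrip {xv R Hs sd : ℝ} (hR : 0 ≤ R) (hs : sd = 1 ∨ sd = -1) {r : ℂ → ℝ}
    (hharm : ∀ u : ℂ, R / 2 ≤ |u.re - xv| → HarmonicAt r u)
    (hdec : Tendsto r (cocompact ℂ) (𝓝 0))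
    (hb : ∀ u : ℂ, ThinStripBdry xv R Hs u → r u ≤ 0) :
    ∀ u ∈ thinHalfStrip xv R Hs sd, r u ≤ 0 := by
  have hf : HarmonicOnNhd r (thinHalfStrip xv R Hs sd) := fun v hv =>
    hharm v (far_of_mem_closure_thinHalfStrip hs (subset_closure hv))
  refine Literature.Analysis.Complex.harmonic_le_of_frontier_of_cocompact isOpen_thinHalfStrip
    (convex_thinHalfStrip hs).isPreconnected hf (M := 0) ?_ ?_
  · intro ζ hζ ε hε
    have hcont : ContinuousAt r ζ :=
      (hharm ζ (far_of_mem_closure_thinHalfStrip hs (frontier_subset_closure hζ))).1.continuousAt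
    have hlt : r ζ < 0 + ε := by linarith [hb ζ (frontier_thinHalfStrip_subset_bdry hR hs hζ)]
    exact (Filter.Tendsto.eventually_le_const hlt hcont.tendsto).filter_mono nhdsWithin_le_nhds
  · intro ε hε
    have hlt : (0 : ℝ) < 0 + ε := by linarith
    exact (Filter.Tendsto.eventually_le_const hlt hdec).filter_mono inf_le_left

/-- **maximum principle on the thin far strip**: harmonic at every far point, `→ 0` at infinity, `≤ 0` on `ThinStripBdry` ⟹ `≤ 0` on `ThinStrip`. -/
theorem nonpos_on_thinStrip {xv R Hs : ℝ} (hR : 0 ≤ R) {r : ℂ → ℝ}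
    (hharm : ∀ u : ℂ, R / 2 ≤ |u.re - xv| → HarmonicAt r u)
    (hdec : Tendsto r (cocompact ℂ) (𝓝 0))
    (hb : ∀ u : ℂ, ThinStripBdry xv R Hs u → r u ≤ 0) :
    ∀ u : ℂ, ThinStrip xv R Hs u → r u ≤ 0 := by
  intro u hu
  rcases hu with ⟨hre, him⟩
  by_cases hb1 : |u.re - xv| = R / 2
  · exact hb u (Or.inl ⟨hb1, him⟩)
  by_cases hb2 : |u.im| = Hs
  · exact hb u (Or.inr ⟨hre, hb2⟩)
  have hre' : R / 2 < |u.re - xv| := lt_of_le_of_ne hre (Ne.symm hb1)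
  have him' : |u.im| < Hs := lt_of_le_of_ne him hb2
  have him2 := abs_lt.1 him'
  rcases le_or_gt 0 (u.re - xv) with h0 | h0
  · have hmem : u ∈ thinHalfStrip xv R Hs 1 := by
      simp only [thinHalfStrip, Set.mem_inter_iff, Set.mem_setOf_eq]
      refine ⟨?_, ?_, ?_⟩ <;> linarith [abs_of_nonneg h0, him2.1, him2.2]
    exact nonpos_on_thinHalfStrip hR (Or.inl rfl) hharm hdec hb u hmem
  · have hmem : u ∈ thinHalfStrip xv R Hs (-1) := by
      simp only [thinHalfStrip, Set.mem_inter_iff, Set.mem_setOf_eq]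
      refine ⟨?_, ?_, ?_⟩ <;> linarith [abs_of_neg h0, him2.1, him2.2]
    exact nonpos_on_thinHalfStrip hR (Or.inr rfl) hharm hdec hb u hmem

/-- **LEMMA H ON THE THIN STRIP** (`LemmaHThinSig` of §1, the converse of `kernelDomThinBdry_of_thin`): boundary kernel domination on the thin strip
implies kernel domination on the whole thin strip — for every real `σ`, all real weights and directions, every finite cut family, every lid height `Hs`;
harmonic bookkeeping (#1257's generator, the thin region), not a law. -/
theorem lemmaHThin : LemmaHThinSig := by
  intro κ _ xv R Hs cs w σ hw hp hB u hu
  have hR : 0 ≤ R := by linarith [abs_nonneg (w.re - xv)]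
  obtain ⟨r, hr⟩ : ∃ r : ℂ → ℝ, r = fun v => (sinkGen cs w σ v).re := ⟨_, rfl⟩
  have hrv : ∀ v : ℂ, r v = cutNumer cs w v - σ * farPairC w v := fun v => by
    rw [hr, cutNumer_sub_eq]
  have hharm : ∀ v : ℂ, R / 2 ≤ |v.re - xv| → HarmonicAt r v := fun v hv => by
    rw [hr]; exact (sinkGen_analyticAt cs w σ hw hp hv).harmonicAt_re
  have hdec : Tendsto r (cocompact ℂ) (𝓝 0) := by
    have h : Tendsto (fun v => (sinkGen cs w σ v).re) (cocompact ℂ) (𝓝 (0 : ℂ).re) :=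
      (Complex.continuous_re.tendsto 0).comp (sinkGen_tendsto cs w σ)
    rw [Complex.zero_re] at h
    rw [hr]; exact h
  have hb : ∀ v : ℂ, ThinStripBdry xv R Hs v → r v ≤ 0 := fun v hv => by
    rw [hrv]; linarith [hB v hv]
  have key := nonpos_on_thinStrip hR hharm hdec hb u hu
  rw [hrv] at key
  linarith

/-- (K∂-thin) ⇔ (K-thin) when the poles are strictly inside the near window. -/
theorem kernelDomThin_iff_bdry {κ : Type} [Fintype κ] {xv R Hs : ℝ} {cs : κ → Cut} {w : ℂ} {σ : ℝ}
    (hw : |w.re - xv| < R / 2) (hp : ∀ k, |(cs k).p.re - xv| < R / 2) :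
    KernelDomThin xv R Hs cs w σ ↔ KernelDomThinBdry xv R Hs cs w σ :=
  ⟨kernelDomThinBdry_of_thin, lemmaHThin κ xv R Hs cs w σ hw hp⟩

end LemmaHThin

end RhW08.SinkThin
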